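import Literature.NumberTheory.Automorphic.ArchRankOneSplitOrbitContinuity           -- ★ FILE 2 (p850189): the identity off the centre, continuity in `x`, the value at the centre
import HarnessLib

/-!
# (A0), JOINT FORM: the Weyl-normalised split orbital integral of `U(Φ₂)(ℂ)` at `hypBlockGL x θ` tends to `C · ∫_{K × N} F(e^{iθ₀} · k n k⁻¹)`
# as `(x, θ) → (0, θ₀)` within `{x ≠ 0}` — the wall value is a limit in ALL chart coordinates

Topic `NumberTheory/Automorphic`; namespace `Literature.NumberTheory.Automorphic.UnitaryGroup`.  KERNEL mathematics only: theorems, no definition, no named fact,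
no instance, no notation, no `sorry`.  Cell `pub/hodgecm-mathlib`, line LH3 (closer stub `stub_N9`, crux H413 = `stmt-HodgeConjecture-24833`), DIRECT ROAD brick
**(A0)-U11 GROUP HALF, joint sequel** to ★ `ArchRankOneSplitOrbitContinuity` (LH5-p04 (g2) 2026-09-02T07:25:34Z docking question: the `hA0` slot of ★
`stOrbFamH_insert_cayPt_eq_mul_prod` reads the split-place limit along the LOCAL TRIPLE `(x, θ₁, θ) → (0, ·, θ₀)` within `{x ≠ 0}`, i.e. JOINTLY in `(x, θ)`).

THE MATHEMATICS.  As in ★ FILE 2: for `x ≠ 0`, `|eˣ − e⁻ˣ| • ∫_{G ⧸ T} F(y · hypBlockGL x θ · y⁻¹) dμ = C • Λ(x, θ)` with the singularity-free chart integral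
`Λ(x, θ) = ∫_{K × N} F(k · (hypBlockGL 0 θ · a(x) n a(x)) · k⁻¹) d(κ ⊗ μ_N)`, `a(x) = hypBlockGL (x∕2) 0` (★ `abs_sub_smul_integral_descConj_hypBlockGL_eq_smul_integral_prod`).
Here (§1) `Λ` is continuous on `ℝ × ℝ` JOINTLY — the integrand is jointly continuous in `(x, θ, k, n)` (★ `continuous_hypBlockGL`) and, for `(x, θ)` in a compact box,
supported in a fixed compact subset of `K × N` (`N` closed, `K` compact; Mathlib `continuous_parametric_integral_of_continuous`) — and (§2) the joint head follows:
**`|eˣ − e⁻ˣ| • ∫_{G ⧸ T} F(y · hypBlockGL x θ · y⁻¹) dμ ⟶ C • ∫_{K × N} F(hypBlockGL 0 θ₀ · k n k⁻¹) d(κ ⊗ μ_N)`** along `𝓝[{x ≠ 0}] (0, θ₀)` (value ★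
`integral_prod_conj_hypBlockGL_half_zero`).  [Varadarajan1989, §6.4 Thm 23]; [Shelstad1979, Lemma 4.3]; [Rogawski1990, §8.2 p. 119].
HONEST LABEL: HC_CM is proved only modulo the 7 printed citations (2 remaining: hLiu418 = stmt-HodgeConjecture-24832, h413 = stmt-HodgeConjecture-24833) until rung 0 closes;
measure theory over Mathlib + ★ FILE 1∕2, count-neutral, pays nothing by itself.

## References
* [Varadarajan1989] V. S. Varadarajan, *An Introduction to Harmonic Analysis on Semisimple Lie Groups*, Cambridge Stud. Adv. Math. 16 (1989), §6.4 Lemma 21, Thm 23.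
* [Shelstad1979] D. Shelstad, *Characters and inner forms of a quasi-split group over ℝ*, Compositio Math. 39 (1979), Lemma 4.3 p. 25.
* [Rogawski1990] J. D. Rogawski, *Automorphic Representations of Unitary Groups in Three Variables*, Ann. of Math. Stud. 123 (1990), §3.6 p. 31, §8.2 p. 119. -/

set_option autoImplicit false

noncomputable section

open MeasureTheory Measure Set Filter Topology
open scoped ENNReal NNReal ComplexConjugate

namespace Literature.NumberTheory.Automorphic

open Literature.MeasureTheory.Group

namespace UnitaryGroup

open Literature.NumberTheory.Automorphic.UnitaryGroup.HeisRing Literature.NumberTheory.Automorphic.UnitaryGroup.LineRing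

section SplitChartJoint

variable {J : Matrix (Fin 2) (Fin 2) ℂ} (hJ : J = (StdForm.antidiagonal 2).over ℂ)
  [MeasurableSpace ↥(unitaryGroupOfForm (starRingEnd ℂ) J)] [BorelSpace ↥(unitaryGroupOfForm (starRingEnd ℂ) J)]
  {K : Subgroup ↥(unitaryGroupOfForm (starRingEnd ℂ) J)} (κ : Measure ↥K)
  (μN : Measure ↥(unipotentU (starRingEnd ℂ) J)) {E : Type*} [NormedAddCommGroup E] [NormedSpace ℝ E]

/-! ## §1 Joint continuity of the chart integral in `(x, θ)` -/

include hJ in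
/-- **(A0), JOINT CONTINUITY OF THE CHART in `(x, θ)`.**  For `K` compact, `κ`, `μ_N` Haar and `F` continuous with compact support,
`(x, θ) ↦ ∫_{K × N} F(k · (hypBlockGL 0 θ · a(x) n a(x)) · k⁻¹) d(κ ⊗ μ_N)`, `a(x) = hypBlockGL (x∕2) 0`, is continuous on `ℝ × ℝ` (the wall value is a limit in
ALL chart coordinates): the integrand is jointly continuous in `(x, θ, k, n)` and, locally in `(x, θ)`, supported in a fixed compact of `K × N`.
[cite: Varadarajan1989, §6.4 Thm 23] [cite: Shelstad1979, Lemma 4.3 p. 25] -/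
theorem continuous_integral_prod_conj_hypBlockGL_half_joint (hK : IsCompact (K : Set ↥(unitaryGroupOfForm (starRingEnd ℂ) J)))
    [IsHaarMeasure κ] [IsHaarMeasure μN] (F : ↥(unitaryGroupOfForm (starRingEnd ℂ) J) → E) (hF : Continuous F) (hFc : HasCompactSupport F) :
    Continuous fun xθ : ℝ × ℝ => ∫ p : ↥K × ↥(unipotentU (starRingEnd ℂ) J),
        F ((p.1 : ↥(unitaryGroupOfForm (starRingEnd ℂ) J)) *
          ((⟨hypBlockGL 0 xθ.2, hypBlockGL_mem_of_eq_over hJ 0 xθ.2⟩ : ↥(unitaryGroupOfForm (starRingEnd ℂ) J)) *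
            (⟨hypBlockGL (xθ.1 / 2) 0, hypBlockGL_mem_of_eq_over hJ (xθ.1 / 2) 0⟩ : ↥(unitaryGroupOfForm (starRingEnd ℂ) J)) *
            (p.2 : ↥(unitaryGroupOfForm (starRingEnd ℂ) J)) *
            (⟨hypBlockGL (xθ.1 / 2) 0, hypBlockGL_mem_of_eq_over hJ (xθ.1 / 2) 0⟩ : ↥(unitaryGroupOfForm (starRingEnd ℂ) J))) *
          (p.1 : ↥(unitaryGroupOfForm (starRingEnd ℂ) J))⁻¹) ∂(κ.prod μN) := by
  haveI : LocallyCompactSpace ↥(unitaryGroupOfForm (starRingEnd ℂ) J) := locallyCompactSpace_unitaryGroupOfForm_complex J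
  haveI : SecondCountableTopology ↥(unitaryGroupOfForm (starRingEnd ℂ) J) := secondCountableTopology_unitaryGroupOfForm_complex J
  have hN : IsClosed (unipotentU (starRingEnd ℂ) J : Set ↥(unitaryGroupOfForm (starRingEnd ℂ) J)) := isClosed_unipotentU _ _
  haveI : LocallyCompactSpace ↥(unipotentU (starRingEnd ℂ) J) := hN.isClosedEmbedding_subtypeVal.locallyCompactSpace
  haveI : SecondCountableTopology ↥(unipotentU (starRingEnd ℂ) J) := TopologicalSpace.Subtype.secondCountableTopology _
  haveI : SecondCountableTopology ↥K := TopologicalSpace.Subtype.secondCountableTopology _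
  haveI : BorelSpace ↥(unipotentU (starRingEnd ℂ) J) := Subtype.borelSpace _
  haveI : BorelSpace ↥K := Subtype.borelSpace _
  haveI : BorelSpace (↥K × ↥(unipotentU (starRingEnd ℂ) J)) := Prod.borelSpace
  haveI : CompactSpace ↥K := isCompact_iff_compactSpace.1 hK
  haveI : LocallyCompactSpace ↥K := hK.isClosed.isClosedEmbedding_subtypeVal.locallyCompactSpace
  -- the moving torus element `a(x)` and the moving centre `z(θ)`
  obtain ⟨z, hz⟩ : ∃ z : ℝ × ℝ → ↥(unitaryGroupOfForm (starRingEnd ℂ) J),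
      z = fun xθ => ⟨hypBlockGL 0 xθ.2, hypBlockGL_mem_of_eq_over hJ 0 xθ.2⟩ := ⟨_, rfl⟩
  obtain ⟨a, ha⟩ : ∃ a : ℝ × ℝ → ↥(unitaryGroupOfForm (starRingEnd ℂ) J),
      a = fun xθ => ⟨hypBlockGL (xθ.1 / 2) 0, hypBlockGL_mem_of_eq_over hJ (xθ.1 / 2) 0⟩ := ⟨_, rfl⟩
  have hzc : Continuous z := by
    rw [hz]
    exact (continuous_hypBlockGL.comp (continuous_const.prodMk continuous_snd)).subtype_mk _
  have hac : Continuous a := by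
    rw [ha]
    exact (continuous_hypBlockGL.comp ((continuous_fst.div_const 2).prodMk continuous_const)).subtype_mk _
  -- the integrand as a function of `(xθ, p)`
  obtain ⟨f, hf⟩ : ∃ f : ℝ × ℝ → ↥K × ↥(unipotentU (starRingEnd ℂ) J) → E, f = fun xθ p =>
      F ((p.1 : ↥(unitaryGroupOfForm (starRingEnd ℂ) J)) * (z xθ * a xθ * (p.2 : ↥(unitaryGroupOfForm (starRingEnd ℂ) J)) * a xθ) *
        (p.1 : ↥(unitaryGroupOfForm (starRingEnd ℂ) J))⁻¹) := ⟨_, rfl⟩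
  have hgoal : (fun xθ : ℝ × ℝ => ∫ p : ↥K × ↥(unipotentU (starRingEnd ℂ) J),
        F ((p.1 : ↥(unitaryGroupOfForm (starRingEnd ℂ) J)) *
          ((⟨hypBlockGL 0 xθ.2, hypBlockGL_mem_of_eq_over hJ 0 xθ.2⟩ : ↥(unitaryGroupOfForm (starRingEnd ℂ) J)) *
            (⟨hypBlockGL (xθ.1 / 2) 0, hypBlockGL_mem_of_eq_over hJ (xθ.1 / 2) 0⟩ : ↥(unitaryGroupOfForm (starRingEnd ℂ) J)) *
            (p.2 : ↥(unitaryGroupOfForm (starRingEnd ℂ) J)) *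
            (⟨hypBlockGL (xθ.1 / 2) 0, hypBlockGL_mem_of_eq_over hJ (xθ.1 / 2) 0⟩ : ↥(unitaryGroupOfForm (starRingEnd ℂ) J))) *
          (p.1 : ↥(unitaryGroupOfForm (starRingEnd ℂ) J))⁻¹) ∂(κ.prod μN)) = fun xθ => ∫ p, f xθ p ∂(κ.prod μN) := by
    rw [hf, ha, hz]
  rw [hgoal]
  have hfc : Continuous f.uncurry := by
    rw [hf]
    refine hF.comp ?_
    have h1 : Continuous fun q : (ℝ × ℝ) × (↥K × ↥(unipotentU (starRingEnd ℂ) J)) => ((q.2.1 : ↥K) : ↥(unitaryGroupOfForm (starRingEnd ℂ) J)) :=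
      continuous_subtype_val.comp (continuous_fst.comp continuous_snd)
    have h2 : Continuous fun q : (ℝ × ℝ) × (↥K × ↥(unipotentU (starRingEnd ℂ) J)) =>
        ((q.2.2 : ↥(unipotentU (starRingEnd ℂ) J)) : ↥(unitaryGroupOfForm (starRingEnd ℂ) J)) :=
      continuous_subtype_val.comp (continuous_snd.comp continuous_snd)
    have h3 : Continuous fun q : (ℝ × ℝ) × (↥K × ↥(unipotentU (starRingEnd ℂ) J)) => a q.1 := hac.comp continuous_fst
    have h4 : Continuous fun q : (ℝ × ℝ) × (↥K × ↥(unipotentU (starRingEnd ℂ) J)) => z q.1 := hzc.comp continuous_fst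
    exact ((h1.mul (((h4.mul h3).mul h2).mul h3)).mul h1.inv)
  refine continuous_iff_continuousAt.2 fun p₀ => ?_
  -- a compact set of `N` carrying the support for `(x, θ)` in the box `[x₀ − 1, x₀ + 1] × [θ₀ − 1, θ₀ + 1]`
  obtain ⟨Ψ, hΨ⟩ : ∃ Ψ : (ℝ × ℝ) × ↥K × ↥(unitaryGroupOfForm (starRingEnd ℂ) J) → ↥(unitaryGroupOfForm (starRingEnd ℂ) J),
      Ψ = fun q => (z q.1 * a q.1)⁻¹ * (((q.2.1 : ↥K) : ↥(unitaryGroupOfForm (starRingEnd ℂ) J))⁻¹ * q.2.2 *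
        ((q.2.1 : ↥K) : ↥(unitaryGroupOfForm (starRingEnd ℂ) J))) * (a q.1)⁻¹ := ⟨_, rfl⟩
  have hΨc : Continuous Ψ := by
    rw [hΨ]
    have h1 : Continuous fun q : (ℝ × ℝ) × ↥K × ↥(unitaryGroupOfForm (starRingEnd ℂ) J) =>
        ((q.2.1 : ↥K) : ↥(unitaryGroupOfForm (starRingEnd ℂ) J)) := continuous_subtype_val.comp (continuous_fst.comp continuous_snd)
    have h3 : Continuous fun q : (ℝ × ℝ) × ↥K × ↥(unitaryGroupOfForm (starRingEnd ℂ) J) => a q.1 := hac.comp continuous_fst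
    have h4 : Continuous fun q : (ℝ × ℝ) × ↥K × ↥(unitaryGroupOfForm (starRingEnd ℂ) J) => z q.1 := hzc.comp continuous_fst
    exact ((h4.mul h3).inv.mul ((h1.inv.mul (continuous_snd.comp continuous_snd)).mul h1)).mul h3.inv
  set U : Set (ℝ × ℝ) := Icc (p₀.1 - 1) (p₀.1 + 1) ×ˢ Icc (p₀.2 - 1) (p₀.2 + 1) with hU
  have hUc : IsCompact U := isCompact_Icc.prod isCompact_Icc
  have hUn : U ∈ 𝓝 p₀ :=
    prod_mem_nhds (Icc_mem_nhds (by linarith) (by linarith)) (Icc_mem_nhds (by linarith) (by linarith))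
  set S₁ : Set ↥(unitaryGroupOfForm (starRingEnd ℂ) J) := Ψ '' (U ×ˢ (univ ×ˢ tsupport F)) with hS₁
  have hS₁c : IsCompact S₁ := ((hUc.prod (isCompact_univ.prod hFc)).image hΨc)
  set N₀ : Set ↥(unipotentU (starRingEnd ℂ) J) := Subtype.val ⁻¹' S₁ with hN₀
  have hN₀c : IsCompact N₀ := hN.isClosedEmbedding_subtypeVal.isCompact_preimage hS₁c
  set s : Set (↥K × ↥(unipotentU (starRingEnd ℂ) J)) := univ ×ˢ N₀ with hs
  have hsc : IsCompact s := isCompact_univ.prod hN₀c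
  -- off `s` the integrand vanishes, for `(x, θ)` in the box
  have hzero : ∀ xθ ∈ U, ∀ p, p ∉ s → f xθ p = 0 := by
    intro xθ hx p hp
    rw [hf]
    by_contra hne
    apply hp
    refine mk_mem_prod (mem_univ _) ?_
    change ((p.2 : ↥(unipotentU (starRingEnd ℂ) J)) : ↥(unitaryGroupOfForm (starRingEnd ℂ) J)) ∈ S₁
    refine ⟨(xθ, p.1, (p.1 : ↥(unitaryGroupOfForm (starRingEnd ℂ) J)) * (z xθ * a xθ * (p.2 : ↥(unitaryGroupOfForm (starRingEnd ℂ) J)) * a xθ) *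
      (p.1 : ↥(unitaryGroupOfForm (starRingEnd ℂ) J))⁻¹), mk_mem_prod hx (mk_mem_prod (mem_univ _) (subset_tsupport _ hne)), ?_⟩
    rw [hΨ]
    simp only
    group
  -- the parametric integral over the compact `s` is continuous, and agrees with ours near `p₀`
  have hcont : Continuous fun xθ => ∫ p in s, f xθ p ∂(κ.prod μN) := continuous_parametric_integral_of_continuous hfc hsc
  refine (hcont.continuousAt (x := p₀)).congr ?_
  filter_upwards [hUn] with xθ hx
  exact setIntegral_eq_integral_of_forall_compl_eq_zero fun p hp => hzero xθ hx p hp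

/-! ## §2 The joint head at the wall point `(0, θ₀)` -/

variable [MeasurableSpace (↥(unitaryGroupOfForm (starRingEnd ℂ) J) ⧸ torusU (starRingEnd ℂ) J)]
  [BorelSpace (↥(unitaryGroupOfForm (starRingEnd ℂ) J) ⧸ torusU (starRingEnd ℂ) J)]
  (μ : Measure (↥(unitaryGroupOfForm (starRingEnd ℂ) J) ⧸ torusU (starRingEnd ℂ) J))

include hJ in
/-- **(A0) HEAD, JOINT FORM — the limit at the wall point `(0, θ₀)` in ALL chart coordinates.**  With `μ = C • ((k, n) ↦ k n T)_*(κ ⊗ μ_N)` on `U(Φ₂)(ℂ) ⧸ T`, `K` compact,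
`F` continuous with compact support: as `(x, θ) → (0, θ₀)` within `{x ≠ 0}`,
**`|eˣ − e⁻ˣ| • ∫_{G ⧸ T} F(y · hypBlockGL x θ · y⁻¹) dμ(y) ⟶ C • ∫_{K × N} F(e^{iθ₀} · k n k⁻¹) d(κ ⊗ μ_N)`** (§4 identity off the centre + §5 joint continuity) — the
`hA0` slot of ★ `stOrbFamH_insert_cayPt_eq_mul_prod` (the wall value of the stable family is a limit along the local triple `(x, θ₁, θ) → (0, ·, θ₀)`).
[cite: Varadarajan1989, §6.4 Lemma 21, Thm 23] [cite: Shelstad1979, Lemma 4.3 p. 25] [cite: Rogawski1990, §8.2 p. 119] -/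
theorem tendsto_abs_sub_smul_integral_descConj_hypBlockGL_joint (hK : IsCompact (K : Set ↥(unitaryGroupOfForm (starRingEnd ℂ) J)))
    [IsHaarMeasure κ] [IsHaarMeasure μN] {C : ℝ≥0}
    (hμC : μ = C • Measure.map
      (fun p : ↥K × ↥(unipotentU (starRingEnd ℂ) J) =>
        (QuotientGroup.mk ((p.1 : ↥(unitaryGroupOfForm (starRingEnd ℂ) J)) * (p.2 : ↥(unitaryGroupOfForm (starRingEnd ℂ) J))) :
          ↥(unitaryGroupOfForm (starRingEnd ℂ) J) ⧸ torusU (starRingEnd ℂ) J))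
      (κ.prod μN))
    (F : ↥(unitaryGroupOfForm (starRingEnd ℂ) J) → E) (hF : Continuous F) (hFc : HasCompactSupport F) (θ₀ : ℝ) :
    Tendsto (fun xθ : ℝ × ℝ => |Real.exp xθ.1 - Real.exp (-xθ.1)| •
        ∫ y, descConj (⟨hypBlockGL xθ.1 xθ.2, hypBlockGL_mem_of_eq_over hJ xθ.1 xθ.2⟩ : ↥(unitaryGroupOfForm (starRingEnd ℂ) J))
          (torusU (starRingEnd ℂ) J) (LineRing.forall_mem_torusU_comm (starRingEnd ℂ) J (hypBlockGL_mem_torusU hJ xθ.1 xθ.2)) F y ∂μ)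
      (𝓝[{xθ : ℝ × ℝ | xθ.1 ≠ 0}] (0, θ₀))
      (𝓝 ((C : ℝ) • ∫ p : ↥K × ↥(unipotentU (starRingEnd ℂ) J),
        F ((⟨hypBlockGL 0 θ₀, hypBlockGL_mem_of_eq_over hJ 0 θ₀⟩ : ↥(unitaryGroupOfForm (starRingEnd ℂ) J)) *
          ((p.1 : ↥(unitaryGroupOfForm (starRingEnd ℂ) J)) * (p.2 : ↥(unitaryGroupOfForm (starRingEnd ℂ) J)) *
            (p.1 : ↥(unitaryGroupOfForm (starRingEnd ℂ) J))⁻¹)) ∂(κ.prod μN))) := by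
  haveI : CompactSpace ↥K := isCompact_iff_compactSpace.1 hK
  have hcont := continuous_integral_prod_conj_hypBlockGL_half_joint hJ κ μN hK F hF hFc
  have h0 := integral_prod_conj_hypBlockGL_half_zero hJ κ μN F θ₀ (K := K) (E := E)
  have hlim := ((hcont.tendsto (0, θ₀)).const_smul (C : ℝ)).mono_left (nhdsWithin_le_nhds (s := {xθ : ℝ × ℝ | xθ.1 ≠ 0}))
  simp only at hlim
  rw [h0] at hlim
  refine hlim.congr' ?_
  filter_upwards [self_mem_nhdsWithin] with xθ hx
  exact (abs_sub_smul_integral_descConj_hypBlockGL_eq_smul_integral_prod hJ κ μN μ hμC F hF xθ.2 hx).symm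

end SplitChartJoint

end UnitaryGroup

end Literature.NumberTheory.Automorphic

end
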